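import Summits.BirchSwinnertonDyer.BirchSwinnertonDyer.Theses.TameQuarticManinParity
import Summits.BirchSwinnertonDyer.BirchSwinnertonDyer.Theorems.TeichmullerTwistDescentTwistedPeriodLatticeIndexFrame
import HarnessLib

/-!
# Route `TameQuarticManinParity`, LINE 25 (bsd-idea-3 g8), support S25 `TprimeTwistLatticeSandwich`
# (stmt-BirchSwinnertonDyer-22692) — PROVED BY NAME: the integral twist-lattice sandwich
# `3·Λ(f) ⊆ g(χ₋₃)·Λ(f ⊗ χ₋₃) ⊆ Λ(f)` for the newform of a curve with `9 ∣ N`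

Cell `pub/bsd-wall`, D-0145 line `route-BirchSwinnertonDyer-TeichmullerTwistDescent`, seat `bsd-line-ttd-p1` g10,
working the planner-of-record's TQMP LINE 25. BSD is NOT proved by this; Manin's conjecture is not proved by this;
nothing about the Gauss index beyond `κ ∣ 9` is proved (D24/N24/O22 stay OPEN).

## Statement (the route decl, paraphrased)

For `W/ℚ` globally minimal (additive at `3` — displayed, not used), a conductor-level datum `D`, `9 ∣ N(W)` and the
primitive quadratic character `χ` mod `3`: (1) `g(χ)·w ∈ Λ(D.f)` for every period `w` of `D.f ⊗ χ`; (2) every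
`z ∈ Λ(D.f)` has `3z = g(χ)·w` for a period `w` of `D.f ⊗ χ`.

## Proof

(1) is Stevens' twisting lemma in the tree's form `gaussSum_mul_mem_periodLattice_of_mem_charTwist` (Stevens 1989
(5.4)). (2) is the index frame of `TeichmullerTwistDescentTwistedPeriodLatticeIndexFrame`
(`natCast_mul_mem_gaussSum_mul_periodLattice_charTwist_of_modularParametrizationData`, this seat g4): the newform
`D.f` of level `N` with `9 ∣ N` has `aₙ = 0` for `3 ∣ n` (Atkin–Lehner Thm. 3), so `(f ⊗ χ) ⊗ χ = f`, the twisting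
lemma applied to `f ⊗ χ` gives `g·Λ(f) ⊆ Λ(f ⊗ χ)`, and `g(χ)² = χ(−1)·3`. The planner's `t = [1, 1/3; 0, 1]`
normaliser route (item docstring) is thereby not needed. Design: theorems only; no definition, no named fact, no
`sorry`; axioms `propext`, `Classical.choice`, `Quot.sound`.
-/

set_option autoImplicit false
-- D-0017: single-problem summit, so `Summit.BirchSwinnertonDyer.BirchSwinnertonDyer.…` repeats a namespace BY DESIGN.
set_option linter.dupNamespace false

noncomputable section

open scoped Classical

namespace Summit.BirchSwinnertonDyer.BirchSwinnertonDyer.Theorems.TameQuarticManinParity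

open Literature.NumberTheory.EllipticCurves Literature.NumberTheory.EllipticCurves.ModularForms
  Summit.BirchSwinnertonDyer.BirchSwinnertonDyer.Theses.TameQuarticManinParity
  Summit.BirchSwinnertonDyer.BirchSwinnertonDyer.Theorems.TeichmullerTwistDescent.TwistedPeriodLatticeIndexFrame

/-- **S25 `TprimeTwistLatticeSandwich`** (stmt-BirchSwinnertonDyer-22692), by name: `3·Λ(f) ⊆ g(χ₋₃)·Λ(f ⊗ χ₋₃) ⊆ Λ(f)`
for the newform `f = D.f` of a curve with `9 ∣ N`. [cite: Stevens1989, Lemma (5.4)] [cite: AtkinLehner1970, Thm. 3] -/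
theorem tprimeTwistLatticeSandwich_proof : TprimeTwistLatticeSandwich := by
  unfold TprimeTwistLatticeSandwich
  intro W _ _ _ _ D h9 χ hχ hprim
  haveI : Fact (Nat.Prime 3) := ⟨Nat.prime_three⟩
  refine ⟨fun w hw ↦ gaussSum_mul_mem_periodLattice_of_mem_charTwist (W.conductorNorm ℤ) (dvd_refl _) h9 hχ
    hprim D.f hw, fun z hz ↦ ?_⟩
  obtain ⟨w, hw, h3⟩ :=
    natCast_mul_mem_gaussSum_mul_periodLattice_charTwist_of_modularParametrizationData W 3 D h9 χ hχ hprim hz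
  exact ⟨w, hw, by exact_mod_cast h3⟩

end Summit.BirchSwinnertonDyer.BirchSwinnertonDyer.Theorems.TameQuarticManinParity

end
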